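import Literature.MathematicalPhysics.QuantumFieldTheory.Balaban1983to89.Node00.Record13SepCoPLiveSelector
import Literature.MathematicalPhysics.QuantumFieldTheory.Balaban1983to89.Node00.Record13BgRowAtDatumUPosOfClassC1
import Literature.MathematicalPhysics.QuantumFieldTheory.Balaban1983to89.Node00.LargeFieldBackgroundCoPOfRecordB

/-!
# NODE 00 (YM-PLAN Track A) — STAGE 13, REV 20 ∕ CLASS EDITION: `Provisos₁₃SepCoP` AND THE K0 BODY AT THE WITNESS OF THE C¹ ROUTE `θ₁₅ᶜᶜ¹ = theta13OfThm1CC1 F N ε₀ ε₂₉ B₃ B₃' a₀ a₁`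
# FROM THE TWO GUARDED CLASS CLAUSES ABOUT def-R's CLASS-(6) MINIMISER `UbgMSCoOfRecord … s 𝐖` OVER THE v1.4 RANGE (windowed partition-compatible run, SEPARATED `s`, regular retained
# datum SATISFYING PRINT'S (7), `𝐖 ∈ solvableDom … (regMSCoOfRecord …) …`) — FILE 15a's socket ∘ FILE 14c's background-generic per-datum supplier, restricted by `cases n; by_cases hsol`
# (solvable datum: `U :=` the minimiser; otherwise def-R's junk `1`, FILE 14c's unit branch) — plan's Cut A; the fact-keyed Cut B closers follow in FILE 15c on the C′ fact

Cell `pub-ymgap`, seat `pub-ymgap-node00-def-K0a` (g7), FILE 15b (= FILE 13c∕14b re-keyed to node00-def-T `Record13SepCo` v1.4; director-ym №149 (3)+(5), №150 (1)–(5)).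
[15] = [Balaban1985Variational], [6] = [Balaban1985RegularSpaces], [III] = [Balaban1988Convergent], [I] = [Balaban1987RG1].

WHAT THIS FILE PROVES (theorems only).
* §1 ★★★ `bgSepCoPAt_theta13OfThm1CC1_of_classBounds (signs) (hclass) (hclassC1)` — the (7)-guarded separated row at the Co carrier at `θ₁₅ᶜᶜ¹` from the two GUARDED class clauses displayed per
  datum over the v1.4 range (level `0` vacuous; level `n+1`: `UbgOfRecord₁₃CoP_succ`, then on the solvable set FILE 14c §2 `bgAtDatumU_theta13OfThm1CC1_of_pos` at `U := UbgMSCoOfRecord … s 𝐖`, off it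
  def-R's `UbgMSCoOfRecord_eq_one_of_not_mem` + FILE 14c's `bgAtDatum_one_theta13OfThm1CC1`); ★★ `provisos₁₃SepCoP_theta13OfThm1CC1_of_classBounds`.
* §2 ★★★★ `exists_k0SepCoP_of_classBounds (F) (hε hε' hB hB' ha₀ ha₁) (hclass) (hclassC1) : ∃ θ : Stage13Params F 2, θ.Provisos₁₃SepCoP F 2 ∧ (θ.ZtUnity F 2 ∧ θ.SlotsNondegenerate₁₃ F 2) ∧
  θ.Admissible F 2` — THE REV-20 K0 BODY FOR `F` ⟸ THE TWO GUARDED CLASS CLAUSES OVER THE v1.4 RANGE AT `θ₁₅ᶜᶜ¹(F, 2)` — NOTHING ELSE.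
* (§3 — the FACT-KEYED closers, plan's Cut B — is FILE 15c `Node00/Record13SepCoInhabitedOfThm1Co7.lean`, keyed on the C′ fact `VariationalThm1RegSepCo7` of node00-def-P11 FILE 11
  (dag-n07-e LOCATED-M4: the un-primed `…Co6` is refutable as typed) and the two-sided β-box (FILE 14d); it files when FILE 11 is in the tree.)

HONEST FRAMING.  Composition of tree theorems; CONDITIONAL on the DISPLAYED guarded class clauses ([15] Thm 1 (8)–(10)'s regularity half for def-R's class-(6) minimiser at (7)-regular
data over print's sequences — `Prop` hypotheses, NEVER asserted); nothing of Bałaban asserted; NOT a discharge; K0 NOT closed by this file; counts unmoved (typed 28∕28 · discharged 5∕28); one finite 𝕋⁴ programme at fixed ε — NOT continuum ∕ OS ∕ mass gap ∕ Clay.  No `sorry`, `axiom`, `def`, `instance`, `notation`.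
STAGE 2 RE-KEY (2026-08-30, (E1) variant (iii-b) of record, director-ym №343 (D5)∕(D6); seat node00-def-R g22): after the `Record13CoP` seam re-point
`UbgOfRecord₁₃CoP (n+1) = UbgMSCoPOfRecordB …` the two guarded class clauses (hclass)∕(hclassC1) are READ AT PRINT's DATUM — `𝐖 ∈ solvableDomB … (regMSCoPOfRecord …) (lamBondsSeq s.Ω n)`
and `UbgMSCoPOfRecordB … s 𝐖` ([Balaban1984PropagatorsII] (2.3) p.224) — token for token; every name, the conclusions and the proof skeleton (`cases n; rw [UbgOfRecord₁₃CoP_succ];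
by_cases hsol`, FILE 14c's background-generic supplier on the solvable set, `UbgMSCoPOfRecordB_eq_one_of_not_mem` + the unit branch off it) are unchanged.

-/

noncomputable section

open MeasureTheory
open scoped Matrix.Norms.L2Operator

namespace Literature.MathematicalPhysics.QuantumFieldTheory.Balaban1983to89.Node00

open T4Continuum B14.Eq218Concrete B15DeterminingSets B15DeterminingSetsB B12RegularSpaces111 B14RegularSpaces234 B14Radii T4AxialGaugeSmallField

/-! ## §1. The (7)-guarded separated row at the Co carrier and `Provisos₁₃SepCoP` AT `θ₁₅ᶜᶜ¹` from the two guarded class clauses over the v1.4 range -/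

section WitnessSepCoP

variable {F : T4Family} {N : ℕ} [NeZero N] {ε₀ ε₂₉ B₃ B₃' a₀ a₁ : ℝ}

/-- **★★★ THE (7)-GUARDED SEPARATED ROW P11 AT THE Co CARRIER AT `θ₁₅ᶜᶜ¹`, PER PARTITION-COMPATIBLE RUN, FROM THE TWO GUARDED CLASS CLAUSES OVER THE v1.4 RANGE** — for separated `s`,
`𝐖 ∈ suppOfRecord₁₃` with print's (7): at level `n+1` the carrier is def-R's class-(6) minimiser (`UbgOfRecord₁₃CoP_succ`); if `𝐖 ∈ solvableDom … (regMSCoOfRecord …) …` the C⁰ clause (hclass) and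
the C¹ clause (hclassC1) for that datum feed FILE 14c §2's background-generic supplier at `U := UbgMSCoOfRecord … s 𝐖`; otherwise the minimiser is def-R's junk `1`
(`UbgMSCoOfRecord_eq_one_of_not_mem`) and FILE 14c's unit branch closes; level `0` is vacuous (`1 ≤ j ≤ 0`).  CONDITIONAL; nothing of Bałaban asserted. [cite: Balaban1985Variational, (6)–(7) p.278, Thm 1 (8)–(10) p.279; Balaban1985RegularSpaces, (1.3)–(1.9) p.77; Balaban1988Convergent, (2.10) p.256, (2.12) p.256, (2.27)–(2.28) p.259, (2.34)–(2.41) p.261, p.257] -/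
theorem bgSepCoPAt_theta13OfThm1CC1_of_classBounds (hε : 0 < ε₀) (hε' : 0 < ε₂₉) (hB : 0 ≤ B₃) (hB' : 0 ≤ B₃') (ha₀ : 0 < a₀) (ha₁ : 0 < a₁)
    (hclass : ∀ (p : B12.RunParams) (n : ℕ), n ≤ p.K → Step.InInterval (theta13OfThm1CC1 F N ε₀ ε₂₉ B₃ B₃' a₀ a₁).γ n (gOfRecord₁₃ F N (theta13OfThm1CC1 F N ε₀ ε₂₉ B₃ B₃' a₀ a₁) p) → PartCompat₁₃ F N (theta13OfThm1CC1 F N ε₀ ε₂₉ B₃ B₃' a₀ a₁) p n →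
      ∀ s : SeqOfRecord F (theta13OfThm1CC1 F N ε₀ ε₂₉ B₃ B₃' a₀ a₁).ν (theta13OfThm1CC1 F N ε₀ ε₂₉ B₃ B₃' a₀ a₁).τ9.M (gOfRecord₁₃ F N (theta13OfThm1CC1 F N ε₀ ε₂₉ B₃ B₃' a₀ a₁) p) p.K n, Sect2.SeqSeparated (theta13OfThm1CC1 F N ε₀ ε₂₉ B₃ B₃' a₀ a₁).ν.M₁ s → ∀ W : MSField (F.P p.K) (SU N),
      W ∈ suppOfRecord₁₃P F N (theta13OfThm1CC1 F N ε₀ ε₂₉ B₃ B₃' a₀ a₁) p n s → Sect2.DataSmall7PTop (avOfRecord F N p.K) s.Ω (suppDomOfRecord F (theta13OfThm1CC1 F N ε₀ ε₂₉ B₃ B₃' a₀ a₁).ν p.K s.Ω) n (fun j => (theta13OfThm1CC1 F N ε₀ ε₂₉ B₃ B₃' a₀ a₁).s2.cR * epsOfRecord (theta13OfThm1CC1 F N ε₀ ε₂₉ B₃ B₃' a₀ a₁).ν (gOfRecord₁₃ F N (theta13OfThm1CC1 F N ε₀ ε₂₉ B₃ B₃' a₀ a₁) p) j) W →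
      W ∈ solvableDomB (avOfRecord F N p.K) (regMSCoPOfRecord F N (theta13OfThm1CC1 F N ε₀ ε₂₉ B₃ B₃' a₀ a₁).ν p.K n s.Ω) (lamBondsSeq s.Ω n) →
      ∀ m, 1 ≤ m → m ≤ n → PlaqSmallOn (omegaPlaqs s.Ω m) (B₃ * ((theta13OfThm1CC1 F N ε₀ ε₂₉ B₃ B₃' a₀ a₁).s2.cR * epsOfRecord (theta13OfThm1CC1 F N ε₀ ε₂₉ B₃ B₃' a₀ a₁).ν (gOfRecord₁₃ F N (theta13OfThm1CC1 F N ε₀ ε₂₉ B₃ B₃' a₀ a₁) p) m) * (F.P p.K).eta m ^ 2)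
        (UbgMSCoPOfRecordB F N (theta13OfThm1CC1 F N ε₀ ε₂₉ B₃ B₃' a₀ a₁).ν (theta13OfThm1CC1 F N ε₀ ε₂₉ B₃ B₃' a₀ a₁).τ9.M (gOfRecord₁₃ F N (theta13OfThm1CC1 F N ε₀ ε₂₉ B₃ B₃' a₀ a₁) p) p.K n s W))
    (hclassC1 : ∀ (p : B12.RunParams) (n : ℕ), n ≤ p.K → Step.InInterval (theta13OfThm1CC1 F N ε₀ ε₂₉ B₃ B₃' a₀ a₁).γ n (gOfRecord₁₃ F N (theta13OfThm1CC1 F N ε₀ ε₂₉ B₃ B₃' a₀ a₁) p) → PartCompat₁₃ F N (theta13OfThm1CC1 F N ε₀ ε₂₉ B₃ B₃' a₀ a₁) p n →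
      ∀ s : SeqOfRecord F (theta13OfThm1CC1 F N ε₀ ε₂₉ B₃ B₃' a₀ a₁).ν (theta13OfThm1CC1 F N ε₀ ε₂₉ B₃ B₃' a₀ a₁).τ9.M (gOfRecord₁₃ F N (theta13OfThm1CC1 F N ε₀ ε₂₉ B₃ B₃' a₀ a₁) p) p.K n, Sect2.SeqSeparated (theta13OfThm1CC1 F N ε₀ ε₂₉ B₃ B₃' a₀ a₁).ν.M₁ s → ∀ W : MSField (F.P p.K) (SU N),
      W ∈ suppOfRecord₁₃P F N (theta13OfThm1CC1 F N ε₀ ε₂₉ B₃ B₃' a₀ a₁) p n s → Sect2.DataSmall7PTop (avOfRecord F N p.K) s.Ω (suppDomOfRecord F (theta13OfThm1CC1 F N ε₀ ε₂₉ B₃ B₃' a₀ a₁).ν p.K s.Ω) n (fun j => (theta13OfThm1CC1 F N ε₀ ε₂₉ B₃ B₃' a₀ a₁).s2.cR * epsOfRecord (theta13OfThm1CC1 F N ε₀ ε₂₉ B₃ B₃' a₀ a₁).ν (gOfRecord₁₃ F N (theta13OfThm1CC1 F N ε₀ ε₂₉ B₃ B₃' a₀ a₁) p) j) W →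
      W ∈ solvableDomB (avOfRecord F N p.K) (regMSCoPOfRecord F N (theta13OfThm1CC1 F N ε₀ ε₂₉ B₃ B₃' a₀ a₁).ν p.K n s.Ω) (lamBondsSeq s.Ω n) →
      ∀ m, 1 ≤ m → m ≤ n → PlaqC1SmallOn (plaqInside (s.Ω m)) (B₃' * ((theta13OfThm1CC1 F N ε₀ ε₂₉ B₃ B₃' a₀ a₁).s2.cR * epsOfRecord (theta13OfThm1CC1 F N ε₀ ε₂₉ B₃ B₃' a₀ a₁).ν (gOfRecord₁₃ F N (theta13OfThm1CC1 F N ε₀ ε₂₉ B₃ B₃' a₀ a₁) p) m) * (F.P p.K).eta m ^ 3)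
        (UbgMSCoPOfRecordB F N (theta13OfThm1CC1 F N ε₀ ε₂₉ B₃ B₃' a₀ a₁).ν (theta13OfThm1CC1 F N ε₀ ε₂₉ B₃ B₃' a₀ a₁).τ9.M (gOfRecord₁₃ F N (theta13OfThm1CC1 F N ε₀ ε₂₉ B₃ B₃' a₀ a₁) p) p.K n s W)) :
    ∀ (p : B12.RunParams) (n : ℕ), n ≤ p.K → Step.InInterval (theta13OfThm1CC1 F N ε₀ ε₂₉ B₃ B₃' a₀ a₁).γ n (gOfRecord₁₃ F N (theta13OfThm1CC1 F N ε₀ ε₂₉ B₃ B₃' a₀ a₁) p) → PartCompat₁₃ F N (theta13OfThm1CC1 F N ε₀ ε₂₉ B₃ B₃' a₀ a₁) p n →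
      ∀ s : SeqOfRecord F (theta13OfThm1CC1 F N ε₀ ε₂₉ B₃ B₃' a₀ a₁).ν (theta13OfThm1CC1 F N ε₀ ε₂₉ B₃ B₃' a₀ a₁).τ9.M (gOfRecord₁₃ F N (theta13OfThm1CC1 F N ε₀ ε₂₉ B₃ B₃' a₀ a₁) p) p.K n, Sect2.SeqSeparated (theta13OfThm1CC1 F N ε₀ ε₂₉ B₃ B₃' a₀ a₁).ν.M₁ s →
      ∀ W : MSField (F.P p.K) (SU N), W ∈ suppOfRecord₁₃P F N (theta13OfThm1CC1 F N ε₀ ε₂₉ B₃ B₃' a₀ a₁) p n s →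
      Sect2.DataSmall7PTop (avOfRecord F N p.K) s.Ω (suppDomOfRecord F (theta13OfThm1CC1 F N ε₀ ε₂₉ B₃ B₃' a₀ a₁).ν p.K s.Ω) n (fun j => (theta13OfThm1CC1 F N ε₀ ε₂₉ B₃ B₃' a₀ a₁).s2.cR * epsOfRecord (theta13OfThm1CC1 F N ε₀ ε₂₉ B₃ B₃' a₀ a₁).ν (gOfRecord₁₃ F N (theta13OfThm1CC1 F N ε₀ ε₂₉ B₃ B₃' a₀ a₁) p) j) W →
      ∀ j, 1 ≤ j → j ≤ n → ∀ X : (Sect2.domSys (F.P p.K) (theta13OfThm1CC1 F N ε₀ ε₂₉ B₃ B₃' a₀ a₁).τ9.M j).Dom,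
      (Sect2.domSites (F.P p.K) (theta13OfThm1CC1 F N ε₀ ε₂₉ B₃ B₃' a₀ a₁).τ9.M j X ⊆ s.Λ j →
        Sect2.ofBackgroundC (settingOfRecord₁₃ F N (theta13OfThm1CC1 F N ε₀ ε₂₉ B₃ B₃' a₀ a₁) p).ι (UbgOfRecord₁₃CoP F N (theta13OfThm1CC1 F N ε₀ ε₂₉ B₃ B₃' a₀ a₁) p n s W) ∈
          Sect2.spaceI (settingOfRecord₁₃ F N (theta13OfThm1CC1 F N ε₀ ε₂₉ B₃ B₃' a₀ a₁) p) ((theta13OfThm1CC1 F N ε₀ ε₂₉ B₃ B₃' a₀ a₁).Rz p.K) (theta13OfThm1CC1 F N ε₀ ε₂₉ B₃ B₃' a₀ a₁).τ9.M j (Sect2.domSites (F.P p.K) (theta13OfThm1CC1 F N ε₀ ε₂₉ B₃ B₃' a₀ a₁).τ9.M j X)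
            ((settingOfRecord₁₃ F N (theta13OfThm1CC1 F N ε₀ ε₂₉ B₃ B₃' a₀ a₁) p).lf.alpha0 ((settingOfRecord₁₃ F N (theta13OfThm1CC1 F N ε₀ ε₂₉ B₃ B₃' a₀ a₁) p).flow.g j)) ((settingOfRecord₁₃ F N (theta13OfThm1CC1 F N ε₀ ε₂₉ B₃ B₃' a₀ a₁) p).lf.alpha1 ((settingOfRecord₁₃ F N (theta13OfThm1CC1 F N ε₀ ε₂₉ B₃ B₃' a₀ a₁) p).flow.g j))) ∧
      (Sect2.admB (F.P p.K) (theta13OfThm1CC1 F N ε₀ ε₂₉ B₃ B₃' a₀ a₁).ν (theta13OfThm1CC1 F N ε₀ ε₂₉ B₃ B₃' a₀ a₁).τ9.M (gOfRecord₁₃ F N (theta13OfThm1CC1 F N ε₀ ε₂₉ B₃ B₃' a₀ a₁) p) s.Ω s.Λ j (Sect2.domSites (F.P p.K) (theta13OfThm1CC1 F N ε₀ ε₂₉ B₃ B₃' a₀ a₁).τ9.M j X) = true →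
        Sect2.ofBackgroundC (settingOfRecord₁₃ F N (theta13OfThm1CC1 F N ε₀ ε₂₉ B₃ B₃' a₀ a₁) p).ι (UbgOfRecord₁₃CoP F N (theta13OfThm1CC1 F N ε₀ ε₂₉ B₃ B₃' a₀ a₁) p n s W) ∈
          Sect2.spaceMS (settingOfRecord₁₃ F N (theta13OfThm1CC1 F N ε₀ ε₂₉ B₃ B₃' a₀ a₁) p) ((theta13OfThm1CC1 F N ε₀ ε₂₉ B₃ B₃' a₀ a₁).Rz p.K) (theta13OfThm1CC1 F N ε₀ ε₂₉ B₃ B₃' a₀ a₁).τ9.M j (Sect2.domSites (F.P p.K) (theta13OfThm1CC1 F N ε₀ ε₂₉ B₃ B₃' a₀ a₁).τ9.M j X) s.Ω) := by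
  intro p n hn hw hpc s hsep W hW h7
  cases n with
  | zero => intro j h1 hj; exfalso; omega
  | succ n =>
    -- level `n + 1`: the Co carrier IS def-R's class-(6) minimiser `UbgMSCoOfRecord … (n+1) s 𝐖` (`UbgOfRecord₁₃CoP_succ`, `rfl`); split on the solvable set
    rw [UbgOfRecord₁₃CoP_succ]
    by_cases hsol : W ∈ solvableDomB (avOfRecord F N p.K) (regMSCoPOfRecord F N (theta13OfThm1CC1 F N ε₀ ε₂₉ B₃ B₃' a₀ a₁).ν p.K (n + 1) s.Ω) (lamBondsSeq s.Ω (n + 1))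
    · exact bgAtDatumUPos_theta13OfThm1CC1_of_pos hε hε' hB hB' ha₀ ha₁ p (n + 1) hn hw hpc s _ (hclass p (n + 1) hn hw hpc s hsep W hW h7 hsol)
        (hclassC1 p (n + 1) hn hw hpc s hsep W hW h7 hsol)
    · rw [UbgMSCoPOfRecordB_eq_one_of_not_mem (theta13OfThm1CC1 F N ε₀ ε₂₉ B₃ B₃' a₀ a₁).ν (theta13OfThm1CC1 F N ε₀ ε₂₉ B₃ B₃' a₀ a₁).τ9.M (gOfRecord₁₃ F N (theta13OfThm1CC1 F N ε₀ ε₂₉ B₃ B₃' a₀ a₁) p) p.K (n + 1) s hsol]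
      exact bgAtDatum_one_theta13OfThm1CC1 hε hε' hB hB' ha₀ ha₁ p (n + 1) hw s

/-- **★★ THE v1.4 PROVISOS OF RECORD AT `θ₁₅ᶜᶜ¹`** from the signs and the two guarded class clauses (FILE 15a's `provisos₁₃SepCoP_theta13LiveOfNumerics_of_bgSepCoP` ∘ ★★★; pins `M = 1 = L⁰`,
`M₁ = 1 ∣ 1`). [cite: Balaban1985Variational, (6)–(7) p.278, Thm 1 (8)–(10) p.279; Balaban1988Convergent, (2.18) p.257, (2.28) p.259, (3.16)–(3.22) pp.268–269, p.245; Balaban1989LargeFieldI, (0.3)–(0.4) p.176] -/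
theorem provisos₁₃SepCoP_theta13OfThm1CC1_of_classBounds (hε : 0 < ε₀) (hε' : 0 < ε₂₉) (hB : 0 ≤ B₃) (hB' : 0 ≤ B₃') (ha₀ : 0 < a₀) (ha₁ : 0 < a₁)
    (hclass : ∀ (p : B12.RunParams) (n : ℕ), n ≤ p.K → Step.InInterval (theta13OfThm1CC1 F N ε₀ ε₂₉ B₃ B₃' a₀ a₁).γ n (gOfRecord₁₃ F N (theta13OfThm1CC1 F N ε₀ ε₂₉ B₃ B₃' a₀ a₁) p) → PartCompat₁₃ F N (theta13OfThm1CC1 F N ε₀ ε₂₉ B₃ B₃' a₀ a₁) p n →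
      ∀ s : SeqOfRecord F (theta13OfThm1CC1 F N ε₀ ε₂₉ B₃ B₃' a₀ a₁).ν (theta13OfThm1CC1 F N ε₀ ε₂₉ B₃ B₃' a₀ a₁).τ9.M (gOfRecord₁₃ F N (theta13OfThm1CC1 F N ε₀ ε₂₉ B₃ B₃' a₀ a₁) p) p.K n, Sect2.SeqSeparated (theta13OfThm1CC1 F N ε₀ ε₂₉ B₃ B₃' a₀ a₁).ν.M₁ s → ∀ W : MSField (F.P p.K) (SU N),
      W ∈ suppOfRecord₁₃P F N (theta13OfThm1CC1 F N ε₀ ε₂₉ B₃ B₃' a₀ a₁) p n s → Sect2.DataSmall7PTop (avOfRecord F N p.K) s.Ω (suppDomOfRecord F (theta13OfThm1CC1 F N ε₀ ε₂₉ B₃ B₃' a₀ a₁).ν p.K s.Ω) n (fun j => (theta13OfThm1CC1 F N ε₀ ε₂₉ B₃ B₃' a₀ a₁).s2.cR * epsOfRecord (theta13OfThm1CC1 F N ε₀ ε₂₉ B₃ B₃' a₀ a₁).ν (gOfRecord₁₃ F N (theta13OfThm1CC1 F N ε₀ ε₂₉ B₃ B₃' a₀ a₁) p) j) W →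
      W ∈ solvableDomB (avOfRecord F N p.K) (regMSCoPOfRecord F N (theta13OfThm1CC1 F N ε₀ ε₂₉ B₃ B₃' a₀ a₁).ν p.K n s.Ω) (lamBondsSeq s.Ω n) →
      ∀ m, 1 ≤ m → m ≤ n → PlaqSmallOn (omegaPlaqs s.Ω m) (B₃ * ((theta13OfThm1CC1 F N ε₀ ε₂₉ B₃ B₃' a₀ a₁).s2.cR * epsOfRecord (theta13OfThm1CC1 F N ε₀ ε₂₉ B₃ B₃' a₀ a₁).ν (gOfRecord₁₃ F N (theta13OfThm1CC1 F N ε₀ ε₂₉ B₃ B₃' a₀ a₁) p) m) * (F.P p.K).eta m ^ 2)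
        (UbgMSCoPOfRecordB F N (theta13OfThm1CC1 F N ε₀ ε₂₉ B₃ B₃' a₀ a₁).ν (theta13OfThm1CC1 F N ε₀ ε₂₉ B₃ B₃' a₀ a₁).τ9.M (gOfRecord₁₃ F N (theta13OfThm1CC1 F N ε₀ ε₂₉ B₃ B₃' a₀ a₁) p) p.K n s W))
    (hclassC1 : ∀ (p : B12.RunParams) (n : ℕ), n ≤ p.K → Step.InInterval (theta13OfThm1CC1 F N ε₀ ε₂₉ B₃ B₃' a₀ a₁).γ n (gOfRecord₁₃ F N (theta13OfThm1CC1 F N ε₀ ε₂₉ B₃ B₃' a₀ a₁) p) → PartCompat₁₃ F N (theta13OfThm1CC1 F N ε₀ ε₂₉ B₃ B₃' a₀ a₁) p n →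
      ∀ s : SeqOfRecord F (theta13OfThm1CC1 F N ε₀ ε₂₉ B₃ B₃' a₀ a₁).ν (theta13OfThm1CC1 F N ε₀ ε₂₉ B₃ B₃' a₀ a₁).τ9.M (gOfRecord₁₃ F N (theta13OfThm1CC1 F N ε₀ ε₂₉ B₃ B₃' a₀ a₁) p) p.K n, Sect2.SeqSeparated (theta13OfThm1CC1 F N ε₀ ε₂₉ B₃ B₃' a₀ a₁).ν.M₁ s → ∀ W : MSField (F.P p.K) (SU N),
      W ∈ suppOfRecord₁₃P F N (theta13OfThm1CC1 F N ε₀ ε₂₉ B₃ B₃' a₀ a₁) p n s → Sect2.DataSmall7PTop (avOfRecord F N p.K) s.Ω (suppDomOfRecord F (theta13OfThm1CC1 F N ε₀ ε₂₉ B₃ B₃' a₀ a₁).ν p.K s.Ω) n (fun j => (theta13OfThm1CC1 F N ε₀ ε₂₉ B₃ B₃' a₀ a₁).s2.cR * epsOfRecord (theta13OfThm1CC1 F N ε₀ ε₂₉ B₃ B₃' a₀ a₁).ν (gOfRecord₁₃ F N (theta13OfThm1CC1 F N ε₀ ε₂₉ B₃ B₃' a₀ a₁) p) j) W →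
      W ∈ solvableDomB (avOfRecord F N p.K) (regMSCoPOfRecord F N (theta13OfThm1CC1 F N ε₀ ε₂₉ B₃ B₃' a₀ a₁).ν p.K n s.Ω) (lamBondsSeq s.Ω n) →
      ∀ m, 1 ≤ m → m ≤ n → PlaqC1SmallOn (plaqInside (s.Ω m)) (B₃' * ((theta13OfThm1CC1 F N ε₀ ε₂₉ B₃ B₃' a₀ a₁).s2.cR * epsOfRecord (theta13OfThm1CC1 F N ε₀ ε₂₉ B₃ B₃' a₀ a₁).ν (gOfRecord₁₃ F N (theta13OfThm1CC1 F N ε₀ ε₂₉ B₃ B₃' a₀ a₁) p) m) * (F.P p.K).eta m ^ 3)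
        (UbgMSCoPOfRecordB F N (theta13OfThm1CC1 F N ε₀ ε₂₉ B₃ B₃' a₀ a₁).ν (theta13OfThm1CC1 F N ε₀ ε₂₉ B₃ B₃' a₀ a₁).τ9.M (gOfRecord₁₃ F N (theta13OfThm1CC1 F N ε₀ ε₂₉ B₃ B₃' a₀ a₁) p) p.K n s W)) :
    (theta13OfThm1CC1 F N ε₀ ε₂₉ B₃ B₃' a₀ a₁).Provisos₁₃SepCoP F N :=
  provisos₁₃SepCoP_theta13LiveOfNumerics_of_bgSepCoP F N (stage12NumericsOfThm1CC1 F.L ε₀ B₃ B₃' a₀ a₁) ε₂₉ ⟨0, rfl⟩ (dvd_refl _)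
    (bgSepCoPAt_theta13OfThm1CC1_of_classBounds hε hε' hB hB' ha₀ ha₁ hclass hclassC1)

end WitnessSepCoP

/-! ## §2. ★★★★ THE REV-20 K0 BODY FOR `F` AT `N = 2` FROM THE TWO GUARDED CLASS CLAUSES OVER THE v1.4 RANGE — socket ∘ supplier (plan's Cut A) -/

section ClosureSepCoP

variable {ε₀ ε₂₉ B₃ B₃' a₀ a₁ : ℝ}

/-- **★★★★ THE REV-20 K0 BODY FOR `F` (`∃ θ, θ.Provisos₁₃SepCoP F 2 ∧ (ZtUnity ∧ SlotsNondegenerate₁₃) ∧ Admissible`) FROM THE TWO GUARDED CLASS CLAUSES OF [15] THEOREM 1 FOR def-R's CLASS-(6)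
MINIMISER AT PRINT'S SEQUENCES AND PRINT'S DATA, AT THE WITNESS OF THE C¹ ROUTE** — under the six signs: (hclass) «for every windowed partition-compatible run, every SEPARATED `s`, every
regular retained datum `𝐖` with print's (7) `Sect2.DataSmall7P` admitting a minimiser over (6) (`𝐖 ∈ solvableDom … (regMSCoOfRecord …) …`), `UbgMSCoOfRecord … s 𝐖` has `|U(∂p) − 1| < B₃·cR·ε_m·η_m²` on
`omegaPlaqs s.Ω m`» ([15] Thm 1 (8)) and (hclassC1) «… covariant adjacent-plaquette differences `< B₃′·cR·ε_m·η_m³` inside `Ω_m`» ((9)–(10), gauge-free reading) at `θ₁₅ᶜᶜ¹(F, 2)`; (C2) is the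
run-level antecedent; rows Z ∕ P12 ∕ G ∕ the nine core rows ∕ the two pins are theorems there.  NO named fact, NO (hcomp), NO (h3I)∕(h3MS).  CONDITIONAL — nothing of Bałaban asserted; K0 NOT
closed here. [cite: Balaban1985Variational, (6)–(7) p.278, Thm 1 (8)–(10) p.279; Balaban1985RegularSpaces, (1.3)–(1.9) p.77; Balaban1988Convergent, Thm 1 p.262, (2.10) p.256, (2.12) p.256, (2.27)–(2.28) p.259, (2.34)–(2.41) p.261, p.257, (3.16)–(3.22) pp.268–269; Balaban1989LargeFieldI, (0.3)–(0.4) p.176] -/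
theorem exists_k0SepCoP_of_classBounds (F : T4Family) (hε : 0 < ε₀) (hε' : 0 < ε₂₉) (hB : 0 ≤ B₃) (hB' : 0 ≤ B₃') (ha₀ : 0 < a₀) (ha₁ : 0 < a₁)
    (hclass : ∀ (p : B12.RunParams) (n : ℕ), n ≤ p.K → Step.InInterval (theta13OfThm1CC1 F 2 ε₀ ε₂₉ B₃ B₃' a₀ a₁).γ n (gOfRecord₁₃ F 2 (theta13OfThm1CC1 F 2 ε₀ ε₂₉ B₃ B₃' a₀ a₁) p) → PartCompat₁₃ F 2 (theta13OfThm1CC1 F 2 ε₀ ε₂₉ B₃ B₃' a₀ a₁) p n →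
      ∀ s : SeqOfRecord F (theta13OfThm1CC1 F 2 ε₀ ε₂₉ B₃ B₃' a₀ a₁).ν (theta13OfThm1CC1 F 2 ε₀ ε₂₉ B₃ B₃' a₀ a₁).τ9.M (gOfRecord₁₃ F 2 (theta13OfThm1CC1 F 2 ε₀ ε₂₉ B₃ B₃' a₀ a₁) p) p.K n, Sect2.SeqSeparated (theta13OfThm1CC1 F 2 ε₀ ε₂₉ B₃ B₃' a₀ a₁).ν.M₁ s → ∀ W : MSField (F.P p.K) (SU 2),
      W ∈ suppOfRecord₁₃P F 2 (theta13OfThm1CC1 F 2 ε₀ ε₂₉ B₃ B₃' a₀ a₁) p n s → Sect2.DataSmall7PTop (avOfRecord F 2 p.K) s.Ω (suppDomOfRecord F (theta13OfThm1CC1 F 2 ε₀ ε₂₉ B₃ B₃' a₀ a₁).ν p.K s.Ω) n (fun j => (theta13OfThm1CC1 F 2 ε₀ ε₂₉ B₃ B₃' a₀ a₁).s2.cR * epsOfRecord (theta13OfThm1CC1 F 2 ε₀ ε₂₉ B₃ B₃' a₀ a₁).ν (gOfRecord₁₃ F 2 (theta13OfThm1CC1 F 2 ε₀ ε₂₉ B₃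 B₃' a₀ a₁) p) j) W →
      W ∈ solvableDomB (avOfRecord F 2 p.K) (regMSCoPOfRecord F 2 (theta13OfThm1CC1 F 2 ε₀ ε₂₉ B₃ B₃' a₀ a₁).ν p.K n s.Ω) (lamBondsSeq s.Ω n) →
      ∀ m, 1 ≤ m → m ≤ n → PlaqSmallOn (omegaPlaqs s.Ω m) (B₃ * ((theta13OfThm1CC1 F 2 ε₀ ε₂₉ B₃ B₃' a₀ a₁).s2.cR * epsOfRecord (theta13OfThm1CC1 F 2 ε₀ ε₂₉ B₃ B₃' a₀ a₁).ν (gOfRecord₁₃ F 2 (theta13OfThm1CC1 F 2 ε₀ ε₂₉ B₃ B₃' a₀ a₁) p) m) * (F.P p.K).eta m ^ 2)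
        (UbgMSCoPOfRecordB F 2 (theta13OfThm1CC1 F 2 ε₀ ε₂₉ B₃ B₃' a₀ a₁).ν (theta13OfThm1CC1 F 2 ε₀ ε₂₉ B₃ B₃' a₀ a₁).τ9.M (gOfRecord₁₃ F 2 (theta13OfThm1CC1 F 2 ε₀ ε₂₉ B₃ B₃' a₀ a₁) p) p.K n s W))
    (hclassC1 : ∀ (p : B12.RunParams) (n : ℕ), n ≤ p.K → Step.InInterval (theta13OfThm1CC1 F 2 ε₀ ε₂₉ B₃ B₃' a₀ a₁).γ n (gOfRecord₁₃ F 2 (theta13OfThm1CC1 F 2 ε₀ ε₂₉ B₃ B₃' a₀ a₁) p) → PartCompat₁₃ F 2 (theta13OfThm1CC1 F 2 ε₀ ε₂₉ B₃ B₃' a₀ a₁) p n →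
      ∀ s : SeqOfRecord F (theta13OfThm1CC1 F 2 ε₀ ε₂₉ B₃ B₃' a₀ a₁).ν (theta13OfThm1CC1 F 2 ε₀ ε₂₉ B₃ B₃' a₀ a₁).τ9.M (gOfRecord₁₃ F 2 (theta13OfThm1CC1 F 2 ε₀ ε₂₉ B₃ B₃' a₀ a₁) p) p.K n, Sect2.SeqSeparated (theta13OfThm1CC1 F 2 ε₀ ε₂₉ B₃ B₃' a₀ a₁).ν.M₁ s → ∀ W : MSField (F.P p.K) (SU 2),
      W ∈ suppOfRecord₁₃P F 2 (theta13OfThm1CC1 F 2 ε₀ ε₂₉ B₃ B₃' a₀ a₁) p n s → Sect2.DataSmall7PTop (avOfRecord F 2 p.K) s.Ω (suppDomOfRecord F (theta13OfThm1CC1 F 2 ε₀ ε₂₉ B₃ B₃' a₀ a₁).ν p.K s.Ω) n (fun j => (theta13OfThm1CC1 F 2 ε₀ ε₂₉ B₃ B₃' a₀ a₁).s2.cR * epsOfRecord (theta13OfThm1CC1 F 2 ε₀ ε₂₉ B₃ B₃' a₀ a₁).ν (gOfRecord₁₃ F 2 (theta13OfThm1CC1 F 2 ε₀ ε₂₉ B₃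 B₃' a₀ a₁) p) j) W →
      W ∈ solvableDomB (avOfRecord F 2 p.K) (regMSCoPOfRecord F 2 (theta13OfThm1CC1 F 2 ε₀ ε₂₉ B₃ B₃' a₀ a₁).ν p.K n s.Ω) (lamBondsSeq s.Ω n) →
      ∀ m, 1 ≤ m → m ≤ n → PlaqC1SmallOn (plaqInside (s.Ω m)) (B₃' * ((theta13OfThm1CC1 F 2 ε₀ ε₂₉ B₃ B₃' a₀ a₁).s2.cR * epsOfRecord (theta13OfThm1CC1 F 2 ε₀ ε₂₉ B₃ B₃' a₀ a₁).ν (gOfRecord₁₃ F 2 (theta13OfThm1CC1 F 2 ε₀ ε₂₉ B₃ B₃' a₀ a₁) p) m) * (F.P p.K).eta m ^ 3)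
        (UbgMSCoPOfRecordB F 2 (theta13OfThm1CC1 F 2 ε₀ ε₂₉ B₃ B₃' a₀ a₁).ν (theta13OfThm1CC1 F 2 ε₀ ε₂₉ B₃ B₃' a₀ a₁).τ9.M (gOfRecord₁₃ F 2 (theta13OfThm1CC1 F 2 ε₀ ε₂₉ B₃ B₃' a₀ a₁) p) p.K n s W)) :
    ∃ θ : Stage13Params F 2, θ.Provisos₁₃SepCoP F 2 ∧ (θ.ZtUnity F 2 ∧ θ.SlotsNondegenerate₁₃ F 2) ∧ θ.Admissible F 2 :=
  exists_k0SepCoP_of_bgSepCoP_theta13LiveOfNumerics F (stage12NumericsOfThm1CC1_pos (L := F.L) hε hB hB' ha₀ ha₁) hε' ⟨0, rfl⟩ (dvd_refl _)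
    (bgSepCoPAt_theta13OfThm1CC1_of_classBounds hε hε' hB hB' ha₀ ha₁ hclass hclassC1)

end ClosureSepCoP

end Literature.MathematicalPhysics.QuantumFieldTheory.Balaban1983to89.Node00

end
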